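import Summits.CriticalPhenomena.PercolationContinuityZ3.Theorems.PercNearOneGluingNoHeavyLowerTailTerminalEdgeStepLeFive
import Summits.CriticalPhenomena.PercolationContinuityZ3.Theorems.PercNearOneGluingNoHeavyLowerTailCubicThreePointTerminalClosure

/-!
# `NoHeavyLowerTail` (crux stmt-CriticalPhenomena-4575): the terminal-edge Bernstein steps of AG⁺ (`Ξ`) and `H_{q+t}` hold on every weighted
# graph with at most five vertices, for ALL edge weights — kernel-checked, three-copy FIBREWISE (Richards-comb) positive (bounded-n rung N₀ = 5)

Support file (prover seat `prim-bnk-1`, bounded-n kernel theorems; `--supports stmt-CriticalPhenomena-4575`; COMPUTATIONAL: the eight `checkC`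
evaluations use `native_decide`).  Companion of `…TerminalEdgeStepLeFive` (the SHK3⁺ step (B1),(B2) and its polarised rows (L1),(L2)).

After prim-lit-2's switching proof of SHK3⁺ (2026-08-19) the rows AG⁺ `Ξ = σ(qt − e₂) − e₃ ≥ 0` and `H_{q+t} = (q+t)(qt − e₂) − e₃ ≥ 0`
(`CubicThreePointTerminal.Xi`, `.Hqt`; `Hqt ⇒ AG⁺ ⇒ SHK3⁺`) remain OPEN for general graphs (tree: `hqt_le_five`, `agPlus_le_five` on `≤ 5` vertices).
Their terminal-edge induction along an apex edge `e = {a,y}` has the same shape as for `F` (`CubicThreePointStep.bernstein_expansion`): with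
`x⁰ = (q,u₁,u₂,u₃,t)` the law of `(a,b,c)` in `G ∖ e` and the transition masses `α₁, α₂, β₁, β₂, β₃`,
  `Φ(x_l) = Φ(x⁰)(1−l)³ + ΦB₁·(1−l)²l + ΦB₂·(1−l)l² + Φ(x¹)l³`,   `ΦB₁ = ∇Φ(x⁰)·x¹`, `ΦB₂ = ∇Φ(x¹)·x⁰`   (`Φ ∈ {Ξ, Hqt}`),
with the EXPLICIT cubics `xiB₁, xiB₂, hqtB₁, hqtB₂` below (`Xi_bernstein_expansion`, `Hqt_bernstein_expansion`, by `ring`), so that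
`Xi_segment_nonneg_of_bernstein` / `Hqt_segment_nonneg_of_bernstein` reduce the rows for `G` to the rows for `G∖e`, `G/e` plus the 4-point step
inequalities (BΞ1),(BΞ2) resp. (BH1),(BH2) — 0 violations on 3.13·10⁶ exact instances n ≤ 7 (ttrl2 bern4/README "AG⁺ Bernstein step", "H_{q+t} census"),
margin → 0⁺ in the sparse corner (BH1: 3.5e−7 at n = 7), no certificate known.

**Theorems** (`∀ n ≤ 5`, every `w`, all pairwise distinct `a b c y : Fin n`; arguments = the `μ`-probabilities `lq … lt`, `lα₁ … lβ₃`):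
`xiStep_le_five` : `0 ≤ xiB₁ … ∧ 0 ≤ xiB₂ …`;  `hqtStep_le_five` : `0 ≤ hqtB₁ … ∧ 0 ≤ hqtB₂ …`;  named rungs `XiStepUpTo 5`, `HqtStepUpTo 5`.
PROOF: the four cubics, expanded into monomials over the ten event probabilities (`xTerms`, bridges `cval_xTerms_*` by `ring`), pass the generic
three-copy checker `checkC` at the standard quadruple of `K₄` and `K₅` (all `4^6` resp. `4^10` tensor-Bernstein fibre sums `≥ 0`) and are transported
along vertex relabellings.  Independent exact recomputation (two C implementations, bitwise-equal fibre arrays; BH1 on K₅: 831 080 zero / 217 496 positive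
fibres, 0 negative): run/shared/lean/prim/prim-l12/prim-bnk-1/.  Nothing is claimed beyond five vertices.
-/

namespace Summit.CriticalPhenomena.PercolationContinuityZ3.Theorems.TerminalEdgeStep

open Finset MeasureTheory OneCutCert CovTransferCert E3GroupSepCert CubicThreePointStep CubicThreePointTerminal
open scoped BigOperators
open Literature.Probability.Percolation Literature.Probability.LatticeModels

/-! ## The Bernstein pieces of `Ξ` and `H_{q+t}` along an apex edge (explicit cubics; any commutative ring) -/

section Algebra

variable {R : Type*} [CommRing R]

/-- `ΞB₁ = ∇Ξ(x⁰)·x¹`: three times the first Bernstein coefficient of AG⁺ along an apex-`a` segment. [this work] -/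
def xiB₁ (q u₁ u₂ u₃ t α₁ α₂ β₁ β₂ β₃ : R) : R :=
  3 * q ^ 2 * t + q ^ 2 * β₁ + q ^ 2 * β₂ + q ^ 2 * β₃ - 3 * q * u₁ * u₂ - 3 * q * u₁ * u₃ + 3 * q * u₁ * t - q * u₁ * α₂ + q * u₁ * β₁ + 2 * q * u₁ * β₂ + 2 * q * u₁ * β₃ - 3 * q * u₂ * u₃ + 3 * q * u₂ * t - q * u₂ * α₁ + 2 * q * u₂ * β₁ + q * u₂ * β₂ + 2 * q * u₂ * β₃ + 3 * q * u₃ * t - q * u₃ * α₁ - q * u₃ * α₂ + 2 * q * u₃ * β₁ + 2 * q * u₃ * β₂ + q * u₃ * β₃ + 3 * q * t ^ 2 - q * t * α₁ - q * t * α₂ + q * t * β₁ + q * t * β₂ + q * t * β₃ - 3 * u₁ ^ 2 * u₂ - 3 * u₁ ^ 2 * u₃ - u₁ ^ 2 * α₂ + u₁ ^ 2 * β₂ + u₁ ^ 2 * β₃ - 3 * u₁ * u₂ ^ 2 - 12 * u₁ * u₂ * u₃ - 3 * u₁ * u₂ * t - u₁ * u₂ * α₁ - u₁ * u₂ * α₂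 + u₁ * u₂ * β₁ + u₁ * u₂ * β₂ + 3 * u₁ * u₂ * β₃ - 3 * u₁ * u₃ ^ 2 - 3 * u₁ * u₃ * t - u₁ * u₃ * α₁ - 3 * u₁ * u₃ * α₂ + u₁ * u₃ * β₁ + 3 * u₁ * u₃ * β₂ + u₁ * u₃ * β₃ - u₁ * t * α₁ - 2 * u₁ * t * α₂ + u₁ * t * β₂ + u₁ * t * β₃ - 3 * u₂ ^ 2 * u₃ - u₂ ^ 2 * α₁ + u₂ ^ 2 * β₁ + u₂ ^ 2 * β₃ - 3 * u₂ * u₃ ^ 2 - 3 * u₂ * u₃ * t - 3 * u₂ * u₃ * α₁ - u₂ * u₃ * α₂ + 3 * u₂ * u₃ * β₁ + u₂ * u₃ * β₂ + u₂ * u₃ * β₃ - 2 * u₂ * t * α₁ - u₂ * t * α₂ + u₂ * t * β₁ + u₂ * t * β₃ - u₃ ^ 2 * α₁ - u₃ ^ 2 * α₂ + u₃ ^ 2 * β₁ + u₃ ^ 2 * β₂ - 2 * u₃ * t * α₁ - 2 * u₃ * t * α₂ + u₃ * t * β₁ + u₃ * t * β₂ - t ^ 2 * α₁ - t ^ 2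 * α₂

/-- `ΞB₂ = ∇Ξ(x¹)·x⁰`: three times the second Bernstein coefficient of AG⁺ along an apex-`a` segment. [this work] -/
def xiB₂ (q u₁ u₂ u₃ t α₁ α₂ β₁ β₂ β₃ : R) : R :=
  3 * q ^ 2 * t + 2 * q ^ 2 * β₁ + 2 * q ^ 2 * β₂ + 2 * q ^ 2 * β₃ - 3 * q * u₁ * u₂ - 3 * q * u₁ * u₃ + 3 * q * u₁ * t - 2 * q * u₁ * α₂ + 2 * q * u₁ * β₁ + 4 * q * u₁ * β₂ + 4 * q * u₁ * β₃ - 3 * q * u₂ * u₃ + 3 * q * u₂ * t - 2 * q * u₂ * α₁ + 4 * q * u₂ * β₁ + 2 * q * u₂ * β₂ + 4 * q * u₂ * β₃ + 3 * q * u₃ * t - 2 * q * u₃ * α₁ - 2 * q * u₃ * α₂ + 4 * q * u₃ * β₁ + 4 * q * u₃ * β₂ + 2 * q * u₃ * β₃ + 3 * q * t ^ 2 - 2 * q * t * α₁ - 2 * q * t * α₂ + 2 * q * t * β₁ + 2 * q * t * β₂ + 2 * q * t * β₃ - q * α₁ * α₂ - q * α₁ * β₁ - q * α₂ * β₂ -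 q * β₁ * β₂ - q * β₁ * β₃ - q * β₂ * β₃ - 3 * u₁ ^ 2 * u₂ - 3 * u₁ ^ 2 * u₃ - 2 * u₁ ^ 2 * α₂ + 2 * u₁ ^ 2 * β₂ + 2 * u₁ ^ 2 * β₃ - 3 * u₁ * u₂ ^ 2 - 12 * u₁ * u₂ * u₃ - 3 * u₁ * u₂ * t - 2 * u₁ * u₂ * α₁ - 2 * u₁ * u₂ * α₂ + 2 * u₁ * u₂ * β₁ + 2 * u₁ * u₂ * β₂ + 6 * u₁ * u₂ * β₃ - 3 * u₁ * u₃ ^ 2 - 3 * u₁ * u₃ * t - 2 * u₁ * u₃ * α₁ - 6 * u₁ * u₃ * α₂ + 2 * u₁ * u₃ * β₁ + 6 * u₁ * u₃ * β₂ + 2 * u₁ * u₃ * β₃ - 2 * u₁ * t * α₁ - 4 * u₁ * t * α₂ + 2 * u₁ * t * β₂ + 2 * u₁ * t * β₃ - u₁ * α₁ * α₂ - u₁ * α₁ * β₁ - u₁ * α₂ * β₂ + u₁ * α₂ * β₃ - u₁ * β₁ * β₂ - u₁ * β₁ * β₃ - 2 * u₁ * β₂ * β₃ - 3 * u₂ ^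 2 * u₃ - 2 * u₂ ^ 2 * α₁ + 2 * u₂ ^ 2 * β₁ + 2 * u₂ ^ 2 * β₃ - 3 * u₂ * u₃ ^ 2 - 3 * u₂ * u₃ * t - 6 * u₂ * u₃ * α₁ - 2 * u₂ * u₃ * α₂ + 6 * u₂ * u₃ * β₁ + 2 * u₂ * u₃ * β₂ + 2 * u₂ * u₃ * β₃ - 4 * u₂ * t * α₁ - 2 * u₂ * t * α₂ + 2 * u₂ * t * β₁ + 2 * u₂ * t * β₃ - u₂ * α₁ * α₂ - u₂ * α₁ * β₁ + u₂ * α₁ * β₃ - u₂ * α₂ * β₂ - u₂ * β₁ * β₂ - 2 * u₂ * β₁ * β₃ - u₂ * β₂ * β₃ - 2 * u₃ ^ 2 * α₁ - 2 * u₃ ^ 2 * α₂ + 2 * u₃ ^ 2 * β₁ + 2 * u₃ ^ 2 * β₂ - 4 * u₃ * t * α₁ - 4 * u₃ * t * α₂ + 2 * u₃ * t * β₁ + 2 * u₃ * t * β₂ - 2 * u₃ * α₁ * α₂ - u₃ * α₁ * β₁ + u₃ * α₁ * β₂ + u₃ * α₂ * β₁ - u₃ * α₂ * β₂ - 2 *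 u₃ * β₁ * β₂ - u₃ * β₁ * β₃ - u₃ * β₂ * β₃ - 2 * t ^ 2 * α₁ - 2 * t ^ 2 * α₂ - t * α₁ * α₂ - t * α₁ * β₁ - t * α₂ * β₂ - t * β₁ * β₂ - t * β₁ * β₃ - t * β₂ * β₃

/-- `HB₁ = ∇Hqt(x⁰)·x¹`: three times the first Bernstein coefficient of `H_{q+t}` along an apex-`a` segment. [this work] -/
def hqtB₁ (q u₁ u₂ u₃ t α₁ α₂ β₁ β₂ β₃ : R) : R :=
  3 * q ^ 2 * t + q ^ 2 * β₁ + q ^ 2 * β₂ + q ^ 2 * β₃ - 3 * q * u₁ * u₂ - 3 * q * u₁ * u₃ - q * u₁ * α₂ + q * u₁ * β₂ + q * u₁ * β₃ - 3 * q * u₂ * u₃ - q * u₂ * α₁ + q * u₂ * β₁ + q * u₂ * β₃ - q * u₃ * α₁ - q * u₃ * α₂ + q * u₃ * β₁ + q * u₃ * β₂ + 3 * q * t ^ 2 - 2 * q * t * α₁ - 2 * q * t * α₂ + 2 * q * t * β₁ + 2 * q * t * β₂ + 2 * q * t * β₃ - 3 * u₁ * u₂ * u₃ - 3 * u₁ *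 u₂ * t + u₁ * u₂ * α₁ + u₁ * u₂ * α₂ - u₁ * u₂ * β₁ - u₁ * u₂ * β₂ - 3 * u₁ * u₃ * t + u₁ * u₃ * α₁ - u₁ * u₃ * β₁ - u₁ * u₃ * β₃ - u₁ * t * α₂ + u₁ * t * β₂ + u₁ * t * β₃ - 3 * u₂ * u₃ * t + u₂ * u₃ * α₂ - u₂ * u₃ * β₂ - u₂ * u₃ * β₃ - u₂ * t * α₁ + u₂ * t * β₁ + u₂ * t * β₃ - u₃ * t * α₁ - u₃ * t * α₂ + u₃ * t * β₁ + u₃ * t * β₂ - t ^ 2 * α₁ - t ^ 2 * α₂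

/-- `HB₂ = ∇Hqt(x¹)·x⁰`: three times the second Bernstein coefficient of `H_{q+t}` along an apex-`a` segment. [this work] -/
def hqtB₂ (q u₁ u₂ u₃ t α₁ α₂ β₁ β₂ β₃ : R) : R :=
  3 * q ^ 2 * t + 2 * q ^ 2 * β₁ + 2 * q ^ 2 * β₂ + 2 * q ^ 2 * β₃ - 3 * q * u₁ * u₂ - 3 * q * u₁ * u₃ - 2 * q * u₁ * α₂ + 2 * q * u₁ * β₂ + 2 * q * u₁ * β₃ - 3 * q * u₂ * u₃ - 2 * q * u₂ * α₁ + 2 * q * u₂ * β₁ + 2 * q * u₂ * β₃ - 2 * q * u₃ * α₁ - 2 * q * u₃ * α₂ + 2 * q * u₃ * β₁ + 2 * q * u₃ * β₂ + 3 * q * t ^ 2 - 4 * q * t * α₁ - 4 * q * t * α₂ + 4 * q * t * β₁ + 4 * q * t * β₂ + 4 * q * t * β₃ - q * α₁ * α₂ - 2 * q * α₁ * β₁ - q * α₁ * β₂ - q * α₁ * β₃ - q * α₂ * β₁ - 2 * q * α₂ * β₂ - q * α₂ * β₃ + q * β₁ ^ 2 + q * β₁ * β₂ + q * β₁ * β₃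 + q * β₂ ^ 2 + q * β₂ * β₃ + q * β₃ ^ 2 - 3 * u₁ * u₂ * u₃ - 3 * u₁ * u₂ * t + 2 * u₁ * u₂ * α₁ + 2 * u₁ * u₂ * α₂ - 2 * u₁ * u₂ * β₁ - 2 * u₁ * u₂ * β₂ - 3 * u₁ * u₃ * t + 2 * u₁ * u₃ * α₁ - 2 * u₁ * u₃ * β₁ - 2 * u₁ * u₃ * β₃ - 2 * u₁ * t * α₂ + 2 * u₁ * t * β₂ + 2 * u₁ * t * β₃ + u₁ * α₁ * α₂ - u₁ * α₁ * β₂ - u₁ * α₁ * β₃ + u₁ * α₂ ^ 2 - u₁ * α₂ * β₁ - 2 * u₁ * α₂ * β₂ - u₁ * α₂ * β₃ + u₁ * β₁ * β₂ + u₁ * β₁ * β₃ + u₁ * β₂ ^ 2 + u₁ * β₂ * β₃ + u₁ * β₃ ^ 2 - 3 * u₂ * u₃ * t + 2 * u₂ * u₃ * α₂ - 2 * u₂ * u₃ * β₂ - 2 * u₂ * u₃ * β₃ - 2 * u₂ * t * α₁ + 2 * u₂ * t * β₁ + 2 * u₂ * t * β₃ + u₂ * α₁ ^ 2 + u₂ *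 α₁ * α₂ - 2 * u₂ * α₁ * β₁ - u₂ * α₁ * β₂ - u₂ * α₁ * β₃ - u₂ * α₂ * β₁ - u₂ * α₂ * β₃ + u₂ * β₁ ^ 2 + u₂ * β₁ * β₂ + u₂ * β₁ * β₃ + u₂ * β₂ * β₃ + u₂ * β₃ ^ 2 - 2 * u₃ * t * α₁ - 2 * u₃ * t * α₂ + 2 * u₃ * t * β₁ + 2 * u₃ * t * β₂ + u₃ * α₁ ^ 2 + u₃ * α₁ * α₂ - 2 * u₃ * α₁ * β₁ - u₃ * α₁ * β₂ - u₃ * α₁ * β₃ + u₃ * α₂ ^ 2 - u₃ * α₂ * β₁ - 2 * u₃ * α₂ * β₂ - u₃ * α₂ * β₃ + u₃ * β₁ ^ 2 + u₃ * β₁ * β₂ + u₃ * β₁ * β₃ + u₃ * β₂ ^ 2 + u₃ * β₂ * β₃ - 2 * t ^ 2 * α₁ - 2 * t ^ 2 * α₂ + t * α₁ ^ 2 + t * α₁ * α₂ - 2 * t * α₁ * β₁ - t * α₁ * β₂ - t * α₁ * β₃ + t * α₂ ^ 2 - t * α₂ * β₁ - 2 * t * α₂ * β₂ - t * α₂ *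 β₃ - t * β₁ * β₂ - t * β₁ * β₃ - t * β₂ * β₃

/-- **Bernstein expansion of AG⁺ along an apex edge** (`x¹ = (q−α₁−α₂, u₁+α₁−β₁, u₂+α₂−β₂, u₃−β₃, t+β₁+β₂+β₃)`). [this work] -/
theorem Xi_bernstein_expansion (q u₁ u₂ u₃ t α₁ α₂ β₁ β₂ β₃ l : R) :
    Xi (q + l * (-α₁ - α₂)) (u₁ + l * (α₁ - β₁)) (u₂ + l * (α₂ - β₂)) (u₃ + l * (-β₃)) (t + l * (β₁ + β₂ + β₃)) =
      Xi q u₁ u₂ u₃ t * (1 - l) ^ 3 + xiB₁ q u₁ u₂ u₃ t α₁ α₂ β₁ β₂ β₃ * ((1 - l) ^ 2 * l) +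
        xiB₂ q u₁ u₂ u₃ t α₁ α₂ β₁ β₂ β₃ * ((1 - l) * l ^ 2) +
        Xi (q - α₁ - α₂) (u₁ + α₁ - β₁) (u₂ + α₂ - β₂) (u₃ - β₃) (t + β₁ + β₂ + β₃) * l ^ 3 := by
  simp only [Xi, xiB₁, xiB₂]
  ring

/-- **Bernstein expansion of `H_{q+t}` along an apex edge.** [this work] -/
theorem Hqt_bernstein_expansion (q u₁ u₂ u₃ t α₁ α₂ β₁ β₂ β₃ l : R) :
    Hqt (q + l * (-α₁ - α₂)) (u₁ + l * (α₁ - β₁)) (u₂ + l * (α₂ - β₂)) (u₃ + l * (-β₃)) (t + l * (β₁ + β₂ + β₃)) =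
      Hqt q u₁ u₂ u₃ t * (1 - l) ^ 3 + hqtB₁ q u₁ u₂ u₃ t α₁ α₂ β₁ β₂ β₃ * ((1 - l) ^ 2 * l) +
        hqtB₂ q u₁ u₂ u₃ t α₁ α₂ β₁ β₂ β₃ * ((1 - l) * l ^ 2) +
        Hqt (q - α₁ - α₂) (u₁ + α₁ - β₁) (u₂ + α₂ - β₂) (u₃ - β₃) (t + β₁ + β₂ + β₃) * l ^ 3 := by
  simp only [Hqt, hqtB₁, hqtB₂]
  ring

end Algebra

/-- **The terminal-edge step for AG⁺**: the row at both endpoint laws plus (BΞ1),(BΞ2) give the row along the whole segment. [this work] -/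
theorem Xi_segment_nonneg_of_bernstein {q u₁ u₂ u₃ t α₁ α₂ β₁ β₂ β₃ l : ℝ}
    (h₀ : 0 ≤ Xi q u₁ u₂ u₃ t) (h₃ : 0 ≤ Xi (q - α₁ - α₂) (u₁ + α₁ - β₁) (u₂ + α₂ - β₂) (u₃ - β₃) (t + β₁ + β₂ + β₃))
    (h₁ : 0 ≤ xiB₁ q u₁ u₂ u₃ t α₁ α₂ β₁ β₂ β₃) (h₂ : 0 ≤ xiB₂ q u₁ u₂ u₃ t α₁ α₂ β₁ β₂ β₃) (hl₀ : 0 ≤ l) (hl₁ : l ≤ 1) :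
    0 ≤ Xi (q + l * (-α₁ - α₂)) (u₁ + l * (α₁ - β₁)) (u₂ + l * (α₂ - β₂)) (u₃ + l * (-β₃)) (t + l * (β₁ + β₂ + β₃)) := by
  rw [Xi_bernstein_expansion]
  exact bernstein_cubic_nonneg h₀ h₁ h₂ h₃ hl₀ hl₁

/-- **The terminal-edge step for `H_{q+t}`.** [this work] -/
theorem Hqt_segment_nonneg_of_bernstein {q u₁ u₂ u₃ t α₁ α₂ β₁ β₂ β₃ l : ℝ}
    (h₀ : 0 ≤ Hqt q u₁ u₂ u₃ t) (h₃ : 0 ≤ Hqt (q - α₁ - α₂) (u₁ + α₁ - β₁) (u₂ + α₂ - β₂) (u₃ - β₃) (t + β₁ + β₂ + β₃))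
    (h₁ : 0 ≤ hqtB₁ q u₁ u₂ u₃ t α₁ α₂ β₁ β₂ β₃) (h₂ : 0 ≤ hqtB₂ q u₁ u₂ u₃ t α₁ α₂ β₁ β₂ β₃) (hl₀ : 0 ≤ l) (hl₁ : l ≤ 1) :
    0 ≤ Hqt (q + l * (-α₁ - α₂)) (u₁ + l * (α₁ - β₁)) (u₂ + l * (α₂ - β₂)) (u₃ + l * (-β₃)) (t + l * (β₁ + β₂ + β₃)) := by
  rw [Hqt_bernstein_expansion]
  exact bernstein_cubic_nonneg h₀ h₁ h₂ h₃ hl₀ hl₁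

/-! ## The four step cubics as term lists over the ten events of `(a, b, c, y)` -/

variable {n : ℕ}

/-- Monomial term lists: `0` = `xiB₁`, `1` = `xiB₂`, `2` = `hqtB₁`, `3` = `hqtB₂`. [this work] -/
def xTerms (i : Fin 4) (x : Quad n) : List (CTerm n) :=
  let a := x.1
  let b := x.2.1
  let c := x.2.2.1
  let y := x.2.2.2
  let Q := pQ a b c
  let U₁ := pU₁ a b c
  let U₂ := pU₂ a b c
  let U₃ := pU₃ a b c
  let T := pT a b c
  let A₁ := pA₁ a b c y
  let A₂ := pA₂ a b c y
  let B₁ := pB₁ a b c y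
  let B₂ := pB₂ a b c y
  let B₃ := pB₃ a b c y
  match i with
  | 0 =>
    [(3, Q, Q, T), (1, Q, Q, B₁), (1, Q, Q, B₂), (1, Q, Q, B₃), (-3, Q, U₁, U₂), (-3, Q, U₁, U₃), (3, Q, U₁, T),
      (-1, Q, U₁, A₂), (1, Q, U₁, B₁), (2, Q, U₁, B₂), (2, Q, U₁, B₃), (-3, Q, U₂, U₃), (3, Q, U₂, T), (-1, Q, U₂, A₁),
      (2, Q, U₂, B₁), (1, Q, U₂, B₂), (2, Q, U₂, B₃), (3, Q, U₃, T), (-1, Q, U₃, A₁), (-1, Q, U₃, A₂), (2, Q, U₃, B₁),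
      (2, Q, U₃, B₂), (1, Q, U₃, B₃), (3, Q, T, T), (-1, Q, T, A₁), (-1, Q, T, A₂), (1, Q, T, B₁), (1, Q, T, B₂),
      (1, Q, T, B₃), (-3, U₁, U₁, U₂), (-3, U₁, U₁, U₃), (-1, U₁, U₁, A₂), (1, U₁, U₁, B₂), (1, U₁, U₁, B₃), (-3, U₁, U₂, U₂),
      (-12, U₁, U₂, U₃), (-3, U₁, U₂, T), (-1, U₁, U₂, A₁), (-1, U₁, U₂, A₂), (1, U₁, U₂, B₁), (1, U₁, U₂, B₂),
      (3, U₁, U₂, B₃), (-3, U₁, U₃, U₃), (-3, U₁, U₃, T), (-1, U₁, U₃, A₁), (-3, U₁, U₃, A₂), (1, U₁, U₃, B₁), (3, U₁, U₃, B₂),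
      (1, U₁, U₃, B₃), (-1, U₁, T, A₁), (-2, U₁, T, A₂), (1, U₁, T, B₂), (1, U₁, T, B₃), (-3, U₂, U₂, U₃), (-1, U₂, U₂, A₁),
      (1, U₂, U₂, B₁), (1, U₂, U₂, B₃), (-3, U₂, U₃, U₃), (-3, U₂, U₃, T), (-3, U₂, U₃, A₁), (-1, U₂, U₃, A₂), (3, U₂, U₃, B₁),
      (1, U₂, U₃, B₂), (1, U₂, U₃, B₃), (-2, U₂, T, A₁), (-1, U₂, T, A₂), (1, U₂, T, B₁), (1, U₂, T, B₃), (-1, U₃, U₃, A₁),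
      (-1, U₃, U₃, A₂), (1, U₃, U₃, B₁), (1, U₃, U₃, B₂), (-2, U₃, T, A₁), (-2, U₃, T, A₂), (1, U₃, T, B₁), (1, U₃, T, B₂),
      (-1, T, T, A₁), (-1, T, T, A₂)]
  | 1 =>
    [(3, Q, Q, T), (2, Q, Q, B₁), (2, Q, Q, B₂), (2, Q, Q, B₃), (-3, Q, U₁, U₂), (-3, Q, U₁, U₃), (3, Q, U₁, T),
      (-2, Q, U₁, A₂), (2, Q, U₁, B₁), (4, Q, U₁, B₂), (4, Q, U₁, B₃), (-3, Q, U₂, U₃), (3, Q, U₂, T), (-2, Q, U₂, A₁),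
      (4, Q, U₂, B₁), (2, Q, U₂, B₂), (4, Q, U₂, B₃), (3, Q, U₃, T), (-2, Q, U₃, A₁), (-2, Q, U₃, A₂), (4, Q, U₃, B₁),
      (4, Q, U₃, B₂), (2, Q, U₃, B₃), (3, Q, T, T), (-2, Q, T, A₁), (-2, Q, T, A₂), (2, Q, T, B₁), (2, Q, T, B₂),
      (2, Q, T, B₃), (-1, Q, A₁, A₂), (-1, Q, A₁, B₁), (-1, Q, A₂, B₂), (-1, Q, B₁, B₂), (-1, Q, B₁, B₃), (-1, Q, B₂, B₃),
      (-3, U₁, U₁, U₂), (-3, U₁, U₁, U₃), (-2, U₁, U₁, A₂), (2, U₁, U₁, B₂), (2, U₁, U₁, B₃), (-3, U₁, U₂, U₂),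
      (-12, U₁, U₂, U₃), (-3, U₁, U₂, T), (-2, U₁, U₂, A₁), (-2, U₁, U₂, A₂), (2, U₁, U₂, B₁), (2, U₁, U₂, B₂),
      (6, U₁, U₂, B₃), (-3, U₁, U₃, U₃), (-3, U₁, U₃, T), (-2, U₁, U₃, A₁), (-6, U₁, U₃, A₂), (2, U₁, U₃, B₁), (6, U₁, U₃, B₂),
      (2, U₁, U₃, B₃), (-2, U₁, T, A₁), (-4, U₁, T, A₂), (2, U₁, T, B₂), (2, U₁, T, B₃), (-1, U₁, A₁, A₂), (-1, U₁, A₁, B₁),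
      (-1, U₁, A₂, B₂), (1, U₁, A₂, B₃), (-1, U₁, B₁, B₂), (-1, U₁, B₁, B₃), (-2, U₁, B₂, B₃), (-3, U₂, U₂, U₃),
      (-2, U₂, U₂, A₁), (2, U₂, U₂, B₁), (2, U₂, U₂, B₃), (-3, U₂, U₃, U₃), (-3, U₂, U₃, T), (-6, U₂, U₃, A₁),
      (-2, U₂, U₃, A₂), (6, U₂, U₃, B₁), (2, U₂, U₃, B₂), (2, U₂, U₃, B₃), (-4, U₂, T, A₁), (-2, U₂, T, A₂), (2, U₂, T, B₁),
      (2, U₂, T, B₃), (-1, U₂, A₁, A₂), (-1, U₂, A₁, B₁), (1, U₂, A₁, B₃), (-1, U₂, A₂, B₂), (-1, U₂, B₁, B₂),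
      (-2, U₂, B₁, B₃), (-1, U₂, B₂, B₃), (-2, U₃, U₃, A₁), (-2, U₃, U₃, A₂), (2, U₃, U₃, B₁), (2, U₃, U₃, B₂),
      (-4, U₃, T, A₁), (-4, U₃, T, A₂), (2, U₃, T, B₁), (2, U₃, T, B₂), (-2, U₃, A₁, A₂), (-1, U₃, A₁, B₁), (1, U₃, A₁, B₂),
      (1, U₃, A₂, B₁), (-1, U₃, A₂, B₂), (-2, U₃, B₁, B₂), (-1, U₃, B₁, B₃), (-1, U₃, B₂, B₃), (-2, T, T, A₁), (-2, T, T, A₂),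
      (-1, T, A₁, A₂), (-1, T, A₁, B₁), (-1, T, A₂, B₂), (-1, T, B₁, B₂), (-1, T, B₁, B₃), (-1, T, B₂, B₃)]
  | 2 =>
    [(3, Q, Q, T), (1, Q, Q, B₁), (1, Q, Q, B₂), (1, Q, Q, B₃), (-3, Q, U₁, U₂), (-3, Q, U₁, U₃), (-1, Q, U₁, A₂),
      (1, Q, U₁, B₂), (1, Q, U₁, B₃), (-3, Q, U₂, U₃), (-1, Q, U₂, A₁), (1, Q, U₂, B₁), (1, Q, U₂, B₃), (-1, Q, U₃, A₁),
      (-1, Q, U₃, A₂), (1, Q, U₃, B₁), (1, Q, U₃, B₂), (3, Q, T, T), (-2, Q, T, A₁), (-2, Q, T, A₂), (2, Q, T, B₁),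
      (2, Q, T, B₂), (2, Q, T, B₃), (-3, U₁, U₂, U₃), (-3, U₁, U₂, T), (1, U₁, U₂, A₁), (1, U₁, U₂, A₂), (-1, U₁, U₂, B₁),
      (-1, U₁, U₂, B₂), (-3, U₁, U₃, T), (1, U₁, U₃, A₁), (-1, U₁, U₃, B₁), (-1, U₁, U₃, B₃), (-1, U₁, T, A₂), (1, U₁, T, B₂),
      (1, U₁, T, B₃), (-3, U₂, U₃, T), (1, U₂, U₃, A₂), (-1, U₂, U₃, B₂), (-1, U₂, U₃, B₃), (-1, U₂, T, A₁), (1, U₂, T, B₁),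
      (1, U₂, T, B₃), (-1, U₃, T, A₁), (-1, U₃, T, A₂), (1, U₃, T, B₁), (1, U₃, T, B₂), (-1, T, T, A₁), (-1, T, T, A₂)]
  | 3 =>
    [(3, Q, Q, T), (2, Q, Q, B₁), (2, Q, Q, B₂), (2, Q, Q, B₃), (-3, Q, U₁, U₂), (-3, Q, U₁, U₃), (-2, Q, U₁, A₂),
      (2, Q, U₁, B₂), (2, Q, U₁, B₃), (-3, Q, U₂, U₃), (-2, Q, U₂, A₁), (2, Q, U₂, B₁), (2, Q, U₂, B₃), (-2, Q, U₃, A₁),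
      (-2, Q, U₃, A₂), (2, Q, U₃, B₁), (2, Q, U₃, B₂), (3, Q, T, T), (-4, Q, T, A₁), (-4, Q, T, A₂), (4, Q, T, B₁),
      (4, Q, T, B₂), (4, Q, T, B₃), (-1, Q, A₁, A₂), (-2, Q, A₁, B₁), (-1, Q, A₁, B₂), (-1, Q, A₁, B₃), (-1, Q, A₂, B₁),
      (-2, Q, A₂, B₂), (-1, Q, A₂, B₃), (1, Q, B₁, B₁), (1, Q, B₁, B₂), (1, Q, B₁, B₃), (1, Q, B₂, B₂), (1, Q, B₂, B₃),
      (1, Q, B₃, B₃), (-3, U₁, U₂, U₃), (-3, U₁, U₂, T), (2, U₁, U₂, A₁), (2, U₁, U₂, A₂), (-2, U₁, U₂, B₁), (-2, U₁, U₂, B₂),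
      (-3, U₁, U₃, T), (2, U₁, U₃, A₁), (-2, U₁, U₃, B₁), (-2, U₁, U₃, B₃), (-2, U₁, T, A₂), (2, U₁, T, B₂), (2, U₁, T, B₃),
      (1, U₁, A₁, A₂), (-1, U₁, A₁, B₂), (-1, U₁, A₁, B₃), (1, U₁, A₂, A₂), (-1, U₁, A₂, B₁), (-2, U₁, A₂, B₂),
      (-1, U₁, A₂, B₃), (1, U₁, B₁, B₂), (1, U₁, B₁, B₃), (1, U₁, B₂, B₂), (1, U₁, B₂, B₃), (1, U₁, B₃, B₃), (-3, U₂, U₃, T),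
      (2, U₂, U₃, A₂), (-2, U₂, U₃, B₂), (-2, U₂, U₃, B₃), (-2, U₂, T, A₁), (2, U₂, T, B₁), (2, U₂, T, B₃), (1, U₂, A₁, A₁),
      (1, U₂, A₁, A₂), (-2, U₂, A₁, B₁), (-1, U₂, A₁, B₂), (-1, U₂, A₁, B₃), (-1, U₂, A₂, B₁), (-1, U₂, A₂, B₃),
      (1, U₂, B₁, B₁), (1, U₂, B₁, B₂), (1, U₂, B₁, B₃), (1, U₂, B₂, B₃), (1, U₂, B₃, B₃), (-2, U₃, T, A₁), (-2, U₃, T, A₂),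
      (2, U₃, T, B₁), (2, U₃, T, B₂), (1, U₃, A₁, A₁), (1, U₃, A₁, A₂), (-2, U₃, A₁, B₁), (-1, U₃, A₁, B₂), (-1, U₃, A₁, B₃),
      (1, U₃, A₂, A₂), (-1, U₃, A₂, B₁), (-2, U₃, A₂, B₂), (-1, U₃, A₂, B₃), (1, U₃, B₁, B₁), (1, U₃, B₁, B₂), (1, U₃, B₁, B₃),
      (1, U₃, B₂, B₂), (1, U₃, B₂, B₃), (-2, T, T, A₁), (-2, T, T, A₂), (1, T, A₁, A₁), (1, T, A₁, A₂), (-2, T, A₁, B₁),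
      (-1, T, A₁, B₂), (-1, T, A₁, B₃), (1, T, A₂, A₂), (-1, T, A₂, B₁), (-2, T, A₂, B₂), (-1, T, A₂, B₃), (-1, T, B₁, B₂),
      (-1, T, B₁, B₃), (-1, T, B₂, B₃)]

/-- Row `i` holds at `(w, x)`. [this work] -/
def XRowHolds (i : Fin 4) (w : Sym2 (Fin n) → unitInterval) (x : Quad n) : Prop := 0 ≤ cval w (xTerms i x)

/-- The term lists under relabelling. [this work] -/
theorem xTerms_relP (i : Fin 4) (τ : Fin n ≃ Fin n) (x : Quad n) :
    ((xTerms i x).map fun z => (z.1, relP τ z.2.1, relP τ z.2.2.1, relP τ z.2.2.2)) = xTerms i (quadmap τ x) := by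
  obtain ⟨a, b, c, y⟩ := x
  fin_cases i <;> rfl

/-- A row is transported along a relabelling of the vertices. [this work] -/
theorem xRowHolds_relabel (i : Fin 4) (σ : Fin n ≃ Fin n) (w : Sym2 (Fin n) → unitInterval) (x : Quad n)
    (h : XRowHolds i w x) : XRowHolds i (relabelW σ w) (quadmap σ x) := by
  unfold XRowHolds at h ⊢
  rw [cval_map_relP, xTerms_relP, quadmap_symm_quadmap]
  exact h

/-- Transport of a row valid at all weights. [this work] -/
theorem xRowHolds_forall_relabel (i : Fin 4) (σ : Fin n ≃ Fin n) {x : Quad n}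
    (h : ∀ w : Sym2 (Fin n) → unitInterval, XRowHolds i w x) (w : Sym2 (Fin n) → unitInterval) :
    XRowHolds i w (quadmap σ x) := by
  have hw : relabelW σ (fun e => w (sym2Equiv σ e)) = w := by
    funext e
    unfold relabelW
    simp only [Equiv.apply_symm_apply]
  rw [← hw]
  exact xRowHolds_relabel i σ _ x (h _)

/-- `K₄`: the four step cubics pass the three-copy check (base `2^28`): all `4^6` fibre sums are `≥ 0`. [this work] -/
theorem checkX4 (i : Fin 4) : checkC 4 28 (xTerms i (quad₀ 4 le_rfl)) = true := by
  fin_cases i <;> native_decide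
/-- `K₅`: the four step cubics pass the three-copy check (base `2^40`): all `4^10` fibre sums are `≥ 0`. [this work] -/
theorem checkX5 (i : Fin 4) : checkC 5 40 (xTerms i (quad₀ 5 (by norm_num))) = true := by
  fin_cases i <;> native_decide

/-- The rows on `Fin 4`. [this work] -/
theorem xRowHolds_four (i : Fin 4) (w : Sym2 (Fin 4) → unitInterval) (a b c y : Fin 4) (hab : a ≠ b) (hac : a ≠ c) (hay : a ≠ y)
    (hbc : b ≠ c) (hby : b ≠ y) (hcy : c ≠ y) : XRowHolds i w (a, b, c, y) := by
  obtain ⟨σ, hσ⟩ := cover_quad4 _ (mem_distinctQuad hab hac hay hbc hby hcy)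
  rw [← hσ]
  exact xRowHolds_forall_relabel i σ (fun w' => checkC_sound 28 _ (checkX4 i) w') w

/-- The rows on `Fin 5`. [this work] -/
theorem xRowHolds_five (i : Fin 4) (w : Sym2 (Fin 5) → unitInterval) (a b c y : Fin 5) (hab : a ≠ b) (hac : a ≠ c) (hay : a ≠ y)
    (hbc : b ≠ c) (hby : b ≠ y) (hcy : c ≠ y) : XRowHolds i w (a, b, c, y) := by
  obtain ⟨σ, hσ⟩ := cover_quad5 _ (mem_distinctQuad hab hac hay hbc hby hcy)
  rw [← hσ]
  exact xRowHolds_forall_relabel i σ (fun w' => checkC_sound 40 _ (checkX5 i) w') w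

/-- **The four step cubics on every weighted graph with at most five vertices.** [this work] -/
theorem xRowHolds_le_five (i : Fin 4) : ∀ n ≤ 5, ∀ (w : Sym2 (Fin n) → unitInterval) (a b c y : Fin n),
    a ≠ b → a ≠ c → a ≠ y → b ≠ c → b ≠ y → c ≠ y → XRowHolds i w (a, b, c, y) := by
  intro n hn w a b c y hab hac hay hbc hby hcy
  interval_cases n
  · exact a.elim0
  · exact absurd (Subsingleton.elim a b) hab
  · have : c = a ∨ c = b := by omega
    rcases this with h | h
    · exact absurd h.symm hac
    · exact absurd h.symm hbc
  · have : y = a ∨ y = b ∨ y = c := by omega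
    rcases this with h | h | h
    · exact absurd h.symm hay
    · exact absurd h.symm hby
    · exact absurd h.symm hcy
  · exact xRowHolds_four i w a b c y hab hac hay hbc hby hcy
  · exact xRowHolds_five i w a b c y hab hac hay hbc hby hcy

/-! ## Bridges to the explicit cubics and the theorems -/

section Bridges

variable (w : Sym2 (Fin n) → unitInterval) (a b c y : Fin n)

/-- Row `0` is `xiB₁` at the event probabilities. [this work] -/
theorem cval_xTerms_zero : cval w (xTerms 0 (a, b, c, y)) = xiB₁ (lq w a b c) (lu₁ w a b c) (lu₂ w a b c) (lu₃ w a b c) (lt w a b c)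
    (lα₁ w a b c y) (lα₂ w a b c y) (lβ₁ w a b c y) (lβ₂ w a b c y) (lβ₃ w a b c y) := by
  unfold cval xTerms
  simp only [List.map_cons, List.map_nil, List.sum_cons, List.sum_nil]
  unfold pr lq lu₁ lu₂ lu₃ lt lα₁ lα₂ lβ₁ lβ₂ lβ₃ xiB₁
  push_cast
  ring

/-- Row `1` is `xiB₂` at the event probabilities. [this work] -/
theorem cval_xTerms_one : cval w (xTerms 1 (a, b, c, y)) = xiB₂ (lq w a b c) (lu₁ w a b c) (lu₂ w a b c) (lu₃ w a b c) (lt w a b c)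
    (lα₁ w a b c y) (lα₂ w a b c y) (lβ₁ w a b c y) (lβ₂ w a b c y) (lβ₃ w a b c y) := by
  unfold cval xTerms
  simp only [List.map_cons, List.map_nil, List.sum_cons, List.sum_nil]
  unfold pr lq lu₁ lu₂ lu₃ lt lα₁ lα₂ lβ₁ lβ₂ lβ₃ xiB₂
  push_cast
  ring

/-- Row `2` is `hqtB₁` at the event probabilities. [this work] -/
theorem cval_xTerms_two : cval w (xTerms 2 (a, b, c, y)) = hqtB₁ (lq w a b c) (lu₁ w a b c) (lu₂ w a b c) (lu₃ w a b c) (lt w a b c)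
    (lα₁ w a b c y) (lα₂ w a b c y) (lβ₁ w a b c y) (lβ₂ w a b c y) (lβ₃ w a b c y) := by
  unfold cval xTerms
  simp only [List.map_cons, List.map_nil, List.sum_cons, List.sum_nil]
  unfold pr lq lu₁ lu₂ lu₃ lt lα₁ lα₂ lβ₁ lβ₂ lβ₃ hqtB₁
  push_cast
  ring

/-- Row `3` is `hqtB₂` at the event probabilities. [this work] -/
theorem cval_xTerms_three : cval w (xTerms 3 (a, b, c, y)) = hqtB₂ (lq w a b c) (lu₁ w a b c) (lu₂ w a b c) (lu₃ w a b c) (lt w a b c)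
    (lα₁ w a b c y) (lα₂ w a b c y) (lβ₁ w a b c y) (lβ₂ w a b c y) (lβ₃ w a b c y) := by
  unfold cval xTerms
  simp only [List.map_cons, List.map_nil, List.sum_cons, List.sum_nil]
  unfold pr lq lu₁ lu₂ lu₃ lt lα₁ lα₂ lβ₁ lβ₂ lβ₃ hqtB₂
  push_cast
  ring

end Bridges

/-- **(BΞ1),(BΞ2) on at most five vertices**: both Bernstein pieces of the AG⁺ apex-edge step are nonnegative for every weighted graph on `n ≤ 5`
vertices and all pairwise distinct `a b c y` (the hypotheses `h₁, h₂` of `Xi_segment_nonneg_of_bernstein` for `G ∖ {a,y}`). [this work] -/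
theorem xiStep_le_five : ∀ n ≤ 5, ∀ (w : Sym2 (Fin n) → unitInterval) (a b c y : Fin n),
    a ≠ b → a ≠ c → a ≠ y → b ≠ c → b ≠ y → c ≠ y →
    0 ≤ xiB₁ (lq w a b c) (lu₁ w a b c) (lu₂ w a b c) (lu₃ w a b c) (lt w a b c)
      (lα₁ w a b c y) (lα₂ w a b c y) (lβ₁ w a b c y) (lβ₂ w a b c y) (lβ₃ w a b c y) ∧
    0 ≤ xiB₂ (lq w a b c) (lu₁ w a b c) (lu₂ w a b c) (lu₃ w a b c) (lt w a b c)
      (lα₁ w a b c y) (lα₂ w a b c y) (lβ₁ w a b c y) (lβ₂ w a b c y) (lβ₃ w a b c y) := by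
  intro n hn w a b c y hab hac hay hbc hby hcy
  refine ⟨?_, ?_⟩
  · have h := xRowHolds_le_five 0 n hn w a b c y hab hac hay hbc hby hcy
    unfold XRowHolds at h
    rwa [cval_xTerms_zero] at h
  · have h := xRowHolds_le_five 1 n hn w a b c y hab hac hay hbc hby hcy
    unfold XRowHolds at h
    rwa [cval_xTerms_one] at h

/-- **(BH1),(BH2) on at most five vertices**: both Bernstein pieces of the `H_{q+t}` apex-edge step are nonnegative for every weighted graph on
`n ≤ 5` vertices and all pairwise distinct `a b c y`. [this work] -/
theorem hqtStep_le_five : ∀ n ≤ 5, ∀ (w : Sym2 (Fin n) → unitInterval) (a b c y : Fin n),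
    a ≠ b → a ≠ c → a ≠ y → b ≠ c → b ≠ y → c ≠ y →
    0 ≤ hqtB₁ (lq w a b c) (lu₁ w a b c) (lu₂ w a b c) (lu₃ w a b c) (lt w a b c)
      (lα₁ w a b c y) (lα₂ w a b c y) (lβ₁ w a b c y) (lβ₂ w a b c y) (lβ₃ w a b c y) ∧
    0 ≤ hqtB₂ (lq w a b c) (lu₁ w a b c) (lu₂ w a b c) (lu₃ w a b c) (lt w a b c)
      (lα₁ w a b c y) (lα₂ w a b c y) (lβ₁ w a b c y) (lβ₂ w a b c y) (lβ₃ w a b c y) := by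
  intro n hn w a b c y hab hac hay hbc hby hcy
  refine ⟨?_, ?_⟩
  · have h := xRowHolds_le_five 2 n hn w a b c y hab hac hay hbc hby hcy
    unfold XRowHolds at h
    rwa [cval_xTerms_two] at h
  · have h := xRowHolds_le_five 3 n hn w a b c y hab hac hay hbc hby hcy
    unfold XRowHolds at h
    rwa [cval_xTerms_three] at h

/-! ## The named bounded-n statements -/

/-- **AG⁺ terminal-edge step up to `N₀` vertices**: (BΞ1) and (BΞ2) at the event probabilities, all graphs on `n ≤ N₀` vertices. [this work] -/
def XiStepUpTo (N₀ : ℕ) : Prop :=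
  ∀ n ≤ N₀, ∀ (w : Sym2 (Fin n) → unitInterval) (a b c y : Fin n), a ≠ b → a ≠ c → a ≠ y → b ≠ c → b ≠ y → c ≠ y →
    0 ≤ xiB₁ (lq w a b c) (lu₁ w a b c) (lu₂ w a b c) (lu₃ w a b c) (lt w a b c)
      (lα₁ w a b c y) (lα₂ w a b c y) (lβ₁ w a b c y) (lβ₂ w a b c y) (lβ₃ w a b c y) ∧
    0 ≤ xiB₂ (lq w a b c) (lu₁ w a b c) (lu₂ w a b c) (lu₃ w a b c) (lt w a b c)
      (lα₁ w a b c y) (lα₂ w a b c y) (lβ₁ w a b c y) (lβ₂ w a b c y) (lβ₃ w a b c y)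

/-- **`H_{q+t}` terminal-edge step up to `N₀` vertices**: (BH1) and (BH2) at the event probabilities, all graphs on `n ≤ N₀` vertices. [this work] -/
def HqtStepUpTo (N₀ : ℕ) : Prop :=
  ∀ n ≤ N₀, ∀ (w : Sym2 (Fin n) → unitInterval) (a b c y : Fin n), a ≠ b → a ≠ c → a ≠ y → b ≠ c → b ≠ y → c ≠ y →
    0 ≤ hqtB₁ (lq w a b c) (lu₁ w a b c) (lu₂ w a b c) (lu₃ w a b c) (lt w a b c)
      (lα₁ w a b c y) (lα₂ w a b c y) (lβ₁ w a b c y) (lβ₂ w a b c y) (lβ₃ w a b c y) ∧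
    0 ≤ hqtB₂ (lq w a b c) (lu₁ w a b c) (lu₂ w a b c) (lu₃ w a b c) (lt w a b c)
      (lα₁ w a b c y) (lα₂ w a b c y) (lβ₁ w a b c y) (lβ₂ w a b c y) (lβ₃ w a b c y)

/-- **Rung `N₀ = 5` of the AG⁺ step.** [this work] -/
theorem xiStepUpTo_five : XiStepUpTo 5 := xiStep_le_five

/-- **Rung `N₀ = 5` of the `H_{q+t}` step.** [this work] -/
theorem hqtStepUpTo_five : HqtStepUpTo 5 := hqtStep_le_five

end Summit.CriticalPhenomena.PercolationContinuityZ3.Theorems.TerminalEdgeStep
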